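import Literature.NumberTheory.GaloisRepresentations.LubinTateHomPoints
import HarnessLib

/-!
# The `π^{n+1}`-division points of `F_g` for an ARBITRARY Lubin–Tate series `g ∈ 𝔉_π`: they are the `[b]_{g,f} λ_{n+1}`,
# `b ∈ 𝒪_F` unique modulo `π^{n+1}`, additive in `b`, and `Γ_F` acts by `σ • [b]_{g,f}λ = [χ_π(σ) b]_{g,f}λ`
# (Cassels–Fröhlich VI §3.6 Prop. 6, Lubin–Tate 1965 Thm. 2 — for every `g`; proofs only)

Topic `NumberTheory/GaloisRepresentations`; namespace `Literature.NumberTheory.GaloisRepresentations` (theorems only; no definition, no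
named fact, no instance).  Sequel of `LubinTateSeriesIndependence.lean` (`absGal_smul_eq_ltSMul_lubinTateChar`: `Γ_F` acts on the
division points of `F_g` through `χ_π`, for every `g ∈ 𝔉_π`) and `LubinTateHomPoints.lean` (the canonical isomorphisms `[a]_{f,g}` on
points).  Notation: `F` a non-archimedean local field, `π` a uniformiser, `f = πX + X^q` the STANDARD series (`ltPoly`), `λ_{n+1} = genPt`
the chosen generator of the `π^{n+1}`-division points of `F_f` in `𝔪_{K_π^{n+1}}` (`K_π^{n+1} = ltField π n`), `g ∈ 𝔉_π` ANY Lubin–Tate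
series over `𝒪_F = LTCoeff F`, and `[b]_{g,f} λ_{n+1} := evalPt₁ (hom _ hg hf b) λ_{n+1}` — the image of `λ_{n+1}` under Lubin–Tate's
`[b]_{g,f} : F_f → F_g`.  We prove that `b ↦ [b]_{g,f} λ_{n+1}` presents the `π^{n+1}`-division points of `F_g` EXACTLY as `𝒪_F/π^{n+1}`,
Galois-equivariantly through `χ_π`:

* `ltSMul_pow_evalPt₁_hom_genPt` — `[π^{n+1}]_g ([b]_{g,f} λ) = 0` (they ARE division points);
* ★ `exists_eq_evalPt₁_hom_genPt` — every `x ∈ 𝔪_{K_π^{n+1}}` with `[π^{n+1}]_g x = 0` is `[b]_{g,f} λ_{n+1}` for some `b ∈ 𝒪_F`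
  (`card_roots_ltPolyIter` transported along `[1]_{g,f}`);
* ★ `evalPt₁_hom_genPt_eq_iff` — `[a]_{g,f} λ = [b]_{g,f} λ ↔ π^{n+1} ∣ a − b` (`ltAct_genPt_eq_iff` along the bijection `[1]_{g,f}`);
* `ltSMul_evalPt₁_hom_genPt` — `[c]_g ([b]_{g,f} λ) = [c b]_{g,f} λ`; `ltAdd_evalPt₁_hom_genPt` — `[a]_{g,f}λ ⊕_g [b]_{g,f}λ = [a + b]_{g,f} λ`;
* ★ `absGal_smul_evalPt₁_hom_genPt` — **`σ • [b]_{g,f} λ_{n+1} = [χ_π(σ) b]_{g,f} λ_{n+1}`** for every `σ ∈ Γ_F` (inside `F̄`).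

So `π^{-(n+1)} b ↦ [b]_{g,f} λ_{n+1}` is an isomorphism `π^{-(n+1)}𝒪_F/𝒪_F ≃ F_g[π^{n+1}](K_π^{n+1})` of `𝒪_F`-modules carrying the
multiplication by `χ_π(σ)` to the Galois action — Cassels–Fröhlich VI §3.6 Prop. 6 / §3.4 Thm. 3 for an arbitrary `g` (e.g. the endomorphism
`[−p]` of the formal group of a supersingular elliptic curve with `a_p = 0` over `ℤ_{p²}`, `SupersingularFormalGroupLubinTateLocalField`).
No statement about number fields is proved here.

## References
* [CasselsFrohlichANT1967] J.-P. Serre, *Local class field theory* (Cassels–Fröhlich Ch. VI), §3.4 Thm. 3, §3.5 Prop. 1–3, §3.6 Prop. 6.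
* [LubinTate1965] J. Lubin, J. Tate, Ann. of Math. 81 (1965), §1 Thm. 1 (8)–(11), §2 Thm. 2 and Cor.
-/

noncomputable section

open Filter Topology Polynomial

namespace Literature.NumberTheory.GaloisRepresentations

section Concrete

open ValuativeRel GaloisRepresentations.IsNonarchimedeanLocalField LubinTate

variable {F : Type*} [Field F] [ValuativeRel F] [TopologicalSpace F] [IsNonarchimedeanLocalField F]

section Normed

-- The normed-field instances on `F` and on the finite subextensions of `F̄` are those declared (as local instances) in
-- `LubinTateTorsion.lean`; they are re-activated here verbatim so that the instances and definitions built there apply.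
attribute [local instance] instUniformSpace_literature rk1 nF nE ltCharIsUniformAddGroup

variable {π : 𝒪[F]} (hπ : (valuation F).IsUniformizer (π : F)) (n : ℕ) {g : PowerSeries (LTCoeff F)}
  (hg : IsLTSeries (LTCoeff.of F π) (residueFieldCard F) g)

/-- `[c]_g ([b]_{g,f} λ_{n+1}) = [c b]_{g,f} λ_{n+1}` (`[c]_g ∘ [b]_{g,f} = [cb]_{g,f}`, Lubin–Tate's (9), on points).
[cite: LubinTate1965, §1 Thm. 1 (9)] -/
theorem ltSMul_evalPt₁_hom_genPt (c b : 𝒪[F]) :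
    ltSMul (maxNilIdeal F (ltField π n)) (isLTRing_LTCoeff hπ) hg (LTCoeff.of F c)
        (evalPt₁ (maxNilIdeal F (ltField π n)) (hom (isLTRing_LTCoeff hπ) hg (isLTSeries_LTCoeff π) (LTCoeff.of F b))
          (constantCoeff_hom _ _ _ _) (genPt hπ n)) =
      evalPt₁ (maxNilIdeal F (ltField π n)) (hom (isLTRing_LTCoeff hπ) hg (isLTSeries_LTCoeff π) (LTCoeff.of F (c * b)))
        (constantCoeff_hom _ _ _ _) (genPt hπ n) := by
  unfold ltSMul
  rw [evalPt₁_hom_evalPt₁_hom, map_mul]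

/-- `[b]_{g,f} λ_{n+1} = [1]_{g,f} ([b]_f λ_{n+1})` (factor through the canonical isomorphism). [cite: LubinTate1965, §1 Thm. 1 (9)] -/
theorem evalPt₁_hom_genPt_eq_evalPt₁_hom_one_ltAct (b : 𝒪[F]) :
    evalPt₁ (maxNilIdeal F (ltField π n)) (hom (isLTRing_LTCoeff hπ) hg (isLTSeries_LTCoeff π) (LTCoeff.of F b))
        (constantCoeff_hom _ _ _ _) (genPt hπ n) =
      evalPt₁ (maxNilIdeal F (ltField π n)) (hom (isLTRing_LTCoeff hπ) hg (isLTSeries_LTCoeff π) 1)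
        (constantCoeff_hom _ _ _ _) (ltAct hπ n b (genPt hπ n)) := by
  unfold ltAct ltSMul
  rw [evalPt₁_hom_evalPt₁_hom, one_mul]

/-- **`[π^{n+1}]_g ([b]_{g,f} λ_{n+1}) = 0`**: the `[b]_{g,f} λ_{n+1}` are `π^{n+1}`-division points of `F_g`.
[cite: CasselsFrohlichANT1967, Ch. VI §3.6 Prop. 6 (a)] -/
theorem ltSMul_pow_evalPt₁_hom_genPt (b : 𝒪[F]) :
    ltSMul (maxNilIdeal F (ltField π n)) (isLTRing_LTCoeff hπ) hg ((LTCoeff.of F π) ^ (n + 1))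
        (evalPt₁ (maxNilIdeal F (ltField π n)) (hom (isLTRing_LTCoeff hπ) hg (isLTSeries_LTCoeff π) (LTCoeff.of F b))
          (constantCoeff_hom _ _ _ _) (genPt hπ n)) = 0 := by
  rw [← map_pow, ltSMul_evalPt₁_hom_genPt, evalPt₁_hom_genPt_eq_evalPt₁_hom_one_ltAct, ltAct_pow_mul_genPt,
    LubinTate.evalPt₁_zero]

/-- ★ **Every `π^{n+1}`-division point of `F_g` in `𝔪_{K_π^{n+1}}` is a `[b]_{g,f} λ_{n+1}`**: transport of «the roots of `f^{(n+1)}` are the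
`[a]_f λ_{n+1}`» (`card_roots_ltPolyIter`) along `[1]_{f,g}` / `[1]_{g,f}`. [cite: CasselsFrohlichANT1967, Ch. VI §3.6 Prop. 6 (a)]
[cite: LubinTate1965, §2 Cor. to Thm. 2] -/
theorem exists_eq_evalPt₁_hom_genPt (x : (maxNilIdeal F (ltField π n)).toIdeal)
    (hx : ltSMul (maxNilIdeal F (ltField π n)) (isLTRing_LTCoeff hπ) hg ((LTCoeff.of F π) ^ (n + 1)) x = 0) :
    ∃ b : 𝒪[F], x = evalPt₁ (maxNilIdeal F (ltField π n)) (hom (isLTRing_LTCoeff hπ) hg (isLTSeries_LTCoeff π) (LTCoeff.of F b))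
      (constantCoeff_hom _ _ _ _) (genPt hπ n) := by
  classical
  have hA := isLTRing_LTCoeff (F := F) hπ
  have hf := isLTSeries_LTCoeff (F := F) π
  -- `y := [1]_{f,g} x` is a `π^{n+1}`-division point of `F_f`
  set y : (maxNilIdeal F (ltField π n)).toIdeal :=
    evalPt₁ (maxNilIdeal F (ltField π n)) (hom hA hf hg 1) (constantCoeff_hom hA hf hg 1) x with hy
  have hy0 : ltSMul (maxNilIdeal F (ltField π n)) hA hf ((LTCoeff.of F π) ^ (n + 1)) y = 0 := by
    rw [hy, ltSMul_evalPt₁_hom_one (maxNilIdeal F (ltField π n)) hA hg hf, hx, LubinTate.evalPt₁_zero]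
  -- hence `y = [b]_f λ_{n+1}` for some `b`
  obtain ⟨-, -, hroots⟩ := card_roots_ltPolyIter hπ n
  have hP0 : (((ltPolyIter F π (n + 1)).map (algebraMap 𝒪[F] F)).map (algebraMap F (ltField π n))) ≠ 0 :=
    (((monic_ltPolyIter π (n + 1)).1.map _).map _).ne_zero
  obtain ⟨b, hb⟩ := hroots ((y : unitBall (ltField π n)) : ltField π n) (by
    rw [Polynomial.mem_roots hP0, Polynomial.IsRoot.def, Polynomial.eval_map, ← Polynomial.aeval_def,
      ← coe_ltSMul_pow hπ (n + 1) y, hy0]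
    rfl)
  have hyb : y = ltAct hπ n b (genPt hπ n) := Subtype.ext (Subtype.ext hb)
  refine ⟨b, ?_⟩
  rw [evalPt₁_hom_genPt_eq_evalPt₁_hom_one_ltAct, ← hyb, hy, evalPt₁_hom_one_evalPt₁_hom_one]

/-- ★ **`[a]_{g,f} λ_{n+1} = [b]_{g,f} λ_{n+1} ↔ a ≡ b (mod π^{n+1})`**: the division points of `F_g` of level `n+1` are parametrised
EXACTLY by `𝒪_F/π^{n+1}` (`ltAct_genPt_eq_iff` along the bijection `[1]_{g,f}`). [cite: CasselsFrohlichANT1967, Ch. VI §3.6 Prop. 6 (a)] -/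
theorem evalPt₁_hom_genPt_eq_iff {a b : 𝒪[F]} :
    evalPt₁ (maxNilIdeal F (ltField π n)) (hom (isLTRing_LTCoeff hπ) hg (isLTSeries_LTCoeff π) (LTCoeff.of F a))
        (constantCoeff_hom _ _ _ _) (genPt hπ n) =
      evalPt₁ (maxNilIdeal F (ltField π n)) (hom (isLTRing_LTCoeff hπ) hg (isLTSeries_LTCoeff π) (LTCoeff.of F b))
        (constantCoeff_hom _ _ _ _) (genPt hπ n) ↔ π ^ (n + 1) ∣ a - b := by
  rw [evalPt₁_hom_genPt_eq_evalPt₁_hom_one_ltAct, evalPt₁_hom_genPt_eq_evalPt₁_hom_one_ltAct,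
    (bijective_evalPt₁_hom_one (maxNilIdeal F (ltField π n)) (isLTRing_LTCoeff hπ) hg (isLTSeries_LTCoeff π)).1.eq_iff,
    ltAct_genPt_eq_iff]

/-- **`[a]_{g,f} λ ⊕_g [b]_{g,f} λ = [a + b]_{g,f} λ`** (Lubin–Tate's (10) on points: `[1]_{g,f}` is additive and `[a]_f λ ⊕_f [b]_f λ = [a+b]_f λ`).
[cite: LubinTate1965, §1 Thm. 1 (10)] -/
theorem ltAdd_evalPt₁_hom_genPt (a b : 𝒪[F]) :
    ltAdd (maxNilIdeal F (ltField π n)) (isLTRing_LTCoeff hπ) hg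
        (evalPt₁ (maxNilIdeal F (ltField π n)) (hom (isLTRing_LTCoeff hπ) hg (isLTSeries_LTCoeff π) (LTCoeff.of F a))
          (constantCoeff_hom _ _ _ _) (genPt hπ n))
        (evalPt₁ (maxNilIdeal F (ltField π n)) (hom (isLTRing_LTCoeff hπ) hg (isLTSeries_LTCoeff π) (LTCoeff.of F b))
          (constantCoeff_hom _ _ _ _) (genPt hπ n)) =
      evalPt₁ (maxNilIdeal F (ltField π n)) (hom (isLTRing_LTCoeff hπ) hg (isLTSeries_LTCoeff π) (LTCoeff.of F (a + b)))
        (constantCoeff_hom _ _ _ _) (genPt hπ n) := by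
  rw [evalPt₁_hom_genPt_eq_evalPt₁_hom_one_ltAct, evalPt₁_hom_genPt_eq_evalPt₁_hom_one_ltAct,
    evalPt₁_hom_genPt_eq_evalPt₁_hom_one_ltAct, ← evalPt₁_hom_ltAdd]
  unfold ltAct
  rw [map_add, add_ltSMul]

/-- ★ **`σ • [b]_{g,f} λ_{n+1} = [χ_π(σ) b]_{g,f} λ_{n+1}`** for every `σ ∈ Γ_F`, inside `F̄`: the Galois group acts on the level-`(n+1)` division
points of `F_g`, in the parametrisation `b ↦ [b]_{g,f} λ_{n+1}`, by multiplication by the Lubin–Tate character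
(`absGal_smul_eq_ltSMul_lubinTateChar` + `ltSMul_evalPt₁_hom_genPt`). [cite: LubinTate1965, §2 Thm. 2 and Cor.]
[cite: CasselsFrohlichANT1967, Ch. VI §3.4 Thm. 3 (b)] -/
theorem absGal_smul_evalPt₁_hom_genPt (σ : Field.absoluteGaloisGroup F) (b : 𝒪[F]) :
    σ • ((((evalPt₁ (maxNilIdeal F (ltField π n)) (hom (isLTRing_LTCoeff hπ) hg (isLTSeries_LTCoeff π) (LTCoeff.of F b))
          (constantCoeff_hom _ _ _ _) (genPt hπ n) : (maxNilIdeal F (ltField π n)).toIdeal) : unitBall (ltField π n)) :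
            ltField π n) : AlgebraicClosure F) =
      ((((evalPt₁ (maxNilIdeal F (ltField π n)) (hom (isLTRing_LTCoeff hπ) hg (isLTSeries_LTCoeff π)
            (LTCoeff.of F ((lubinTateChar hπ σ : 𝒪[F]) * b)))
          (constantCoeff_hom _ _ _ _) (genPt hπ n) : (maxNilIdeal F (ltField π n)).toIdeal) : unitBall (ltField π n)) :
            ltField π n) : AlgebraicClosure F) := by
  rw [absGal_smul_eq_ltSMul_lubinTateChar hπ n hg _ (ltSMul_pow_evalPt₁_hom_genPt hπ n hg b) σ, ltSMul_evalPt₁_hom_genPt]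

end Normed

end Concrete

end Literature.NumberTheory.GaloisRepresentations

end
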